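import Literature.NumberTheory.GaloisRepresentations.GaloisCohomologyLayerInflationCup
import HarnessLib

/-!
# The directed system of finite Galois layers: `Inf_{E → E'}` on Mathlib's `groupCohomology` and the
# transitivity `inf_{E'} ∘ Inf_{E → E'} = inf_E` into `galoisCohomology` (degrees `1` and `2`)
# (Serre, *Galois Cohomology* I §2.2 Prop. 8: `H^q(G, A) = lim→ H^q(G/U, A^U)` — the transition maps)

Topic `NumberTheory/GaloisRepresentations`; namespace `Literature.NumberTheory.GaloisRepresentations`.
Definitions with bodies and theorems; no named fact, no instance, no notation.  Sequel to
`GaloisCohomologyLayerInflationTwo` (door-c6 g9: `absGaloisLayerRep ρ E`, `infTwo`, `infTwo_H2π`) and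
`GaloisCohomologyLayerInflationCup` (door-c6 g10: `infOneLayer`, `infOneLayer_H1π`).

For a field `K : Type`, finite normal layers `E ≤ E'` inside `K̄` (`Γ_{E'} ≤ Γ_E`,
`absGaloisFixingSubgroup_antitone`) and a discrete `Γ_K`-module `ρ` on `M`:

* §1 `layerQuotientMap E E' h : Γ_K ⧸ Γ_{E'} →* Γ_K ⧸ Γ_E` and the inclusion
  `layerInclHom : Res (M^{Γ_E}) ⟶ M^{Γ_{E'}}` of layer modules (a morphism of `Rep ℤ (Γ_K ⧸ Γ_{E'})`);
  **`layerInf E E' h n : Hⁿ(Γ_K ⧸ Γ_E, M^{Γ_E}) ⟶ Hⁿ(Γ_K ⧸ Γ_{E'}, M^{Γ_{E'}})`** = Mathlib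
  `groupCohomology.map` — THE transition map `Inf` of the directed system of finite layers (the maps the
  class-module engine's `ClassModuleQuotient` / door-c4's `map_baseChangeHom_comp_eq_inflation` speak).
* §2 **`infTwo_layerInf`**: `infTwo ρ E' (layerInf E E' h 2 x) = infTwo ρ E x` and
  **`infOneLayer_layerInf`**: `infOneLayer ρ E' (layerInf E E' h 1 x) = infOneLayer ρ E x` — inflation to
  `Γ_K` is compatible with the transition maps (both sides are the class of `(σ, τ) ↦ f(σ̄, τ̄)`, resp.
  `σ ↦ f(σ̄)`); cocycle identities `inflateTwoCocycle_mapCocycles₂_layerIncl`,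
  `inflateOneCocycle_mapCocycles₁_layerIncl`.
* §3 consequences: `infTwo_eq_of_layerInf_eq` (classes of different layers with a common inflation in
  a bigger layer have the same image in `H²(K, M)`), and with `exists_infOneLayer_eq`: `range infOneLayer`
  grows along the system (`range_infOneLayer_mono`, `range_infTwo_mono`).

This makes `(Hⁿ(Gal(E/K), M^{Γ_E}))_E` with the `layerInf` a directed system over the finite Galois
layers whose inflations into `Hⁿ(K, M)` are compatible — the shape in which Route A's limit arguments
(Milne I Lemma 1.9: transition maps `(U:V)·Inf`; Lemma 4.13) are run.  HONEST FRAMING: homological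
algebra; nothing arithmetic is proved here.

## References
* J.-P. Serre, *Galois Cohomology* (1997), Ch. I §2.2 Prop. 8 (and its proof: compatibility of the
  inflations `H^q(G/U, A^U) → H^q(G/V, A^V) → H^q(G, A)`). [SerreGaloisCohomology1997]
* J. Neukirch, A. Schmidt, K. Wingberg, *Cohomology of Number Fields* (2008), (1.5.1), (1.5.2)
  (transitivity of inflation). [NeukirchSchmidtWingberg2008]
-/

noncomputable section

open CategoryTheory groupCohomology Field Function

namespace Literature.NumberTheory.GaloisRepresentations

open LocalWeilDatum

variable (K : Type) [Field K]
variable (E E' : IntermediateField K (AlgebraicClosure K)) [FiniteDimensional K E] [Normal K E]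
  [FiniteDimensional K E'] [Normal K E']

/-! ## §1. The transition maps of the directed system of finite layers -/

omit [FiniteDimensional K E] [FiniteDimensional K E'] in
/-- `E ≤ E' ⟹ Gal(K̄/E') ≤ Gal(K̄/E)`. [cite: SerreGaloisCohomology1997, I §2.2] -/
theorem absGaloisFixingSubgroup_antitone (h : E ≤ E') :
    absGaloisFixingSubgroup E' ≤ absGaloisFixingSubgroup E := fun σ hσ =>
  (mem_absGaloisFixingSubgroup_iff E σ).2 fun x hx => (mem_absGaloisFixingSubgroup_iff E' σ).1 hσ x (h hx)

omit [FiniteDimensional K E] [FiniteDimensional K E'] in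
/-- **The quotient map `Γ_K ⧸ Γ_{E'} →* Γ_K ⧸ Γ_E`** for `E ≤ E'` (`[σ]_{E'} ↦ [σ]_E`).
[cite: SerreGaloisCohomology1997, I §2.2 Prop. 8] -/
def layerQuotientMap (h : E ≤ E') :
    absoluteGaloisGroup K ⧸ absGaloisFixingSubgroup E' →* absoluteGaloisGroup K ⧸ absGaloisFixingSubgroup E :=
  QuotientGroup.map (absGaloisFixingSubgroup E') (absGaloisFixingSubgroup E) (MonoidHom.id _)
    (by rw [Subgroup.comap_id]; exact absGaloisFixingSubgroup_antitone K E E' h)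

omit [FiniteDimensional K E] [FiniteDimensional K E'] in
/-- `layerQuotientMap [σ] = [σ]`. [cite: SerreGaloisCohomology1997, I §2.2 Prop. 8] -/
@[simp] theorem layerQuotientMap_mk (h : E ≤ E') (σ : absoluteGaloisGroup K) :
    layerQuotientMap K E E' h (σ : absoluteGaloisGroup K ⧸ absGaloisFixingSubgroup E') =
      (σ : absoluteGaloisGroup K ⧸ absGaloisFixingSubgroup E) := rfl

variable {M : Type} [AddCommGroup M] [TopologicalSpace M] [DiscreteTopology M] (ρ : DiscreteGaloisModule K M)

omit [FiniteDimensional K E] [FiniteDimensional K E'] in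
/-- **The inclusion `M^{Γ_E} ↪ M^{Γ_{E'}}` as a morphism `Res (M^{Γ_E}) ⟶ M^{Γ_{E'}}` of
`Rep ℤ (Γ_K ⧸ Γ_{E'})`** (the restriction along `layerQuotientMap`): the coefficient map of the inflation
`Inf : Hⁿ(Γ_K ⧸ Γ_E, M^{Γ_E}) → Hⁿ(Γ_K ⧸ Γ_{E'}, M^{Γ_{E'}})`. [cite: SerreGaloisCohomology1997, I §2.2 Prop. 8]
[cite: NeukirchSchmidtWingberg2008, (1.5.1)] -/
def layerInclHom (h : E ≤ E') :
    Rep.res (layerQuotientMap K E E' h) (absGaloisLayerRep K E ρ) ⟶ absGaloisLayerRep K E' ρ :=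
  Rep.ofHom (LinearMap.intertwiningMap_of_isIntertwiningMap _ _
    (Submodule.inclusion (p' := Representation.invariants
        (ρ.toRepresentation.comp (absGaloisFixingSubgroup E').subtype))
      (fun _ hw s => hw ⟨(s : absoluteGaloisGroup K), absGaloisFixingSubgroup_antitone K E E' h s.2⟩))
    fun q w => by
      induction q using QuotientGroup.induction_on with
      | H σ => rfl)

omit [FiniteDimensional K E] [FiniteDimensional K E'] in
/-- Unfolding: `layerInclHom w = w` in `M`. [cite: SerreGaloisCohomology1997, I §2.2] -/
@[simp] theorem layerInclHom_hom_apply_coe (h : E ≤ E')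
    (w : Representation.invariants (ρ.toRepresentation.comp (absGaloisFixingSubgroup E).subtype)) :
    ((layerInclHom K E E' ρ h).hom w : M) = (w : M) := rfl

omit [FiniteDimensional K E] [FiniteDimensional K E'] in
/-- **The transition map `Inf_{E → E'} : Hⁿ(Γ_K ⧸ Γ_E, M^{Γ_E}) ⟶ Hⁿ(Γ_K ⧸ Γ_{E'}, M^{Γ_{E'}})` of the
directed system of finite layers** (Mathlib `groupCohomology.map` along `layerQuotientMap` and
`layerInclHom`). [cite: SerreGaloisCohomology1997, I §2.2 Prop. 8][cite: NeukirchSchmidtWingberg2008, (1.5.1)] -/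
def layerInf (h : E ≤ E') (n : ℕ) :
    groupCohomology (absGaloisLayerRep K E ρ) n ⟶ groupCohomology (absGaloisLayerRep K E' ρ) n :=
  groupCohomology.map (layerQuotientMap K E E' h) (layerInclHom K E E' ρ h) n

/-! ## §2. Transitivity: `inf_{E'} ∘ Inf_{E → E'} = inf_E` -/

/-- **Cocycle identity in degree two**: inflating to `Γ_K` the cocycle `Inf_{E→E'} f`, `(q₁, q₂) ↦ f(q̄₁, q̄₂)`,
gives the same continuous 2-cocycle `(σ, τ) ↦ f(σ̄, τ̄)` as inflating `f`.
[cite: SerreGaloisCohomology1997, I §2.2 Prop. 8 (proof)] -/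
theorem inflateTwoCocycle_mapCocycles₂_layerIncl (h : E ≤ E') (f : cocycles₂ (absGaloisLayerRep K E ρ)) :
    inflateTwoCocycle K E' ρ (mapCocycles₂ (layerQuotientMap K E E' h) (layerInclHom K E E' ρ h) f) =
      inflateTwoCocycle K E ρ f := by
  refine Subtype.ext (ContinuousMap.ext fun p => ?_)
  obtain ⟨σ, τ⟩ := p
  rw [inflateTwoCocycle_apply, inflateTwoCocycle_apply, coe_mapCocycles₂]
  rfl

/-- **Transitivity of inflation in degree two: `infTwo ρ E' (Inf_{E→E'} x) = infTwo ρ E x`.**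
[cite: SerreGaloisCohomology1997, I §2.2 Prop. 8][cite: NeukirchSchmidtWingberg2008, (1.5.2)] -/
theorem infTwo_layerInf (h : E ≤ E') (x : groupCohomology (absGaloisLayerRep K E ρ) 2) :
    infTwo K E' ρ (layerInf K E E' ρ h 2 x) = infTwo K E ρ x := by
  haveI : CompactSpace (absoluteGaloisGroup K) := absoluteGaloisGroup_compactSpace K
  induction x using H2_induction_on with
  | h f =>
  have e1 : layerInf K E E' ρ h 2 (H2π (absGaloisLayerRep K E ρ) f) =
      H2π (absGaloisLayerRep K E' ρ) (mapCocycles₂ (layerQuotientMap K E E' h) (layerInclHom K E E' ρ h) f) :=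
    H2π_comp_map_apply (layerQuotientMap K E E' h) (layerInclHom K E E' ρ h) f
  have e2 := infTwo_H2π K E' ρ (mapCocycles₂ (layerQuotientMap K E E' h) (layerInclHom K E E' ρ h) f)
  have e3 := infTwo_H2π K E ρ f
  exact (congrArg (infTwo K E' ρ) e1).trans ((e2.trans (congrArg (twoCocycleClass ρ.toTopRep)
    (inflateTwoCocycle_mapCocycles₂_layerIncl K E E' ρ h f))).trans e3.symm)

/-- **Cocycle identity in degree one**: `σ ↦ (Inf f)(σ̄_{E'}) = f(σ̄_E)`.
[cite: SerreGaloisCohomology1997, I §2.2 Prop. 8 (proof)] -/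
theorem inflateOneCocycle_mapCocycles₁_layerIncl (h : E ≤ E') (f : cocycles₁ (absGaloisLayerRep K E ρ)) :
    inflateOneCocycle K E' ρ (mapCocycles₁ (layerQuotientMap K E E' h) (layerInclHom K E E' ρ h) f) =
      inflateOneCocycle K E ρ f := by
  refine Subtype.ext (ContinuousMap.ext fun σ => ?_)
  rw [inflateOneCocycle_apply, inflateOneCocycle_apply, coe_mapCocycles₁]
  rfl

/-- **Transitivity of inflation in degree one: `infOneLayer ρ E' (Inf_{E→E'} x) = infOneLayer ρ E x`.**
[cite: SerreGaloisCohomology1997, I §2.2 Prop. 8][cite: NeukirchSchmidtWingberg2008, (1.5.2)] -/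
theorem infOneLayer_layerInf (h : E ≤ E') (x : groupCohomology (absGaloisLayerRep K E ρ) 1) :
    infOneLayer K E' ρ (layerInf K E E' ρ h 1 x) = infOneLayer K E ρ x := by
  haveI : CompactSpace (absoluteGaloisGroup K) := absoluteGaloisGroup_compactSpace K
  induction x using H1_induction_on with
  | h f =>
  have e1 : layerInf K E E' ρ h 1 (H1π (absGaloisLayerRep K E ρ) f) =
      H1π (absGaloisLayerRep K E' ρ) (mapCocycles₁ (layerQuotientMap K E E' h) (layerInclHom K E E' ρ h) f) :=
    H1π_comp_map_apply (layerQuotientMap K E E' h) (layerInclHom K E E' ρ h) f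
  have e2 := infOneLayer_H1π K E' ρ (mapCocycles₁ (layerQuotientMap K E E' h) (layerInclHom K E E' ρ h) f)
  have e3 := infOneLayer_H1π K E ρ f
  exact (congrArg (infOneLayer K E' ρ) e1).trans ((e2.trans (congrArg (oneCocycleClass ρ.toTopRep)
    (inflateOneCocycle_mapCocycles₁_layerIncl K E E' ρ h f))).trans e3.symm)

/-! ## §3. Consequences -/

/-- Classes `x ∈ H²(layer E)`, `x' ∈ H²(layer E″)` whose transitions agree in a common bigger layer `E'`
have the same image in `H²(K, M)`. [cite: SerreGaloisCohomology1997, I §2.2 Prop. 8] -/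
theorem infTwo_eq_of_layerInf_eq (E'' : IntermediateField K (AlgebraicClosure K)) [FiniteDimensional K E'']
    [Normal K E''] (h : E ≤ E') (h'' : E'' ≤ E')
    {x : groupCohomology (absGaloisLayerRep K E ρ) 2} {x' : groupCohomology (absGaloisLayerRep K E'' ρ) 2}
    (hxx' : layerInf K E E' ρ h 2 x = layerInf K E'' E' ρ h'' 2 x') : infTwo K E ρ x = infTwo K E'' ρ x' := by
  rw [← infTwo_layerInf K E E' ρ h x, hxx', infTwo_layerInf K E'' E' ρ h'' x']

/-- The images `inf(H²(layer E)) ⊆ H²(K, M)` grow along the system: `E ≤ E' ⟹ range ⊆ range`.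
[cite: SerreGaloisCohomology1997, I §2.2 Prop. 8 (the direct limit is a union)] -/
theorem range_infTwo_mono (h : E ≤ E') : Set.range (infTwo K E ρ) ⊆ Set.range (infTwo K E' ρ) := by
  rintro _ ⟨x, rfl⟩
  exact ⟨layerInf K E E' ρ h 2 x, infTwo_layerInf K E E' ρ h x⟩

/-- The images `inf(H¹(layer E)) ⊆ H¹(K, M)` grow along the system.
[cite: SerreGaloisCohomology1997, I §2.2 Prop. 8 (the direct limit is a union)] -/
theorem range_infOneLayer_mono (h : E ≤ E') :
    Set.range (infOneLayer K E ρ) ⊆ Set.range (infOneLayer K E' ρ) := by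
  rintro _ ⟨x, rfl⟩
  exact ⟨layerInf K E E' ρ h 1 x, infOneLayer_layerInf K E E' ρ h x⟩

end Literature.NumberTheory.GaloisRepresentations

end
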